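import Summits.Ventures.HodgeRepro2.T5SU11SphericalDecayFluxIdentity
import Summits.Ventures.HodgeRepro2.T5SU11KernelEnds
import Summits.Ventures.HodgeRepro2.T5SU11KernelResolventIdentity
import Summits.Ventures.HodgeRepro2.T5SU11KernelDifferenceRegularity

/-!
# The resolvent of a decaying solution: `G^I_{λ₂} χ_λ = (χ_λ − χ_{λ₂})/(μ − μ₂)`

The kernel resolvent identity `K_λ(t, s) − K_{λ₂}(t, s) = (μ − μ₂) ∫ K_λ(t, r) K_{λ₂}(r, s) sinh 2r dr` (row 5xx) is read at the origin
`t → 0⁺`, where `K_λ(t, ·) → −χ_λ` (row 624) under the domination `|K_λ(t, r)| ≤ Φ_λ χ_λ(r)` for `t ≤ 1` (`φ_λ ≤ Φ_λ` on `[0, 1]` and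
`χ_λ` decreasing, row 636):

* `abs_kernel_le_mul_sphDecay_of_le_one` — **`|K_λ(t, r)| ≤ Φ_λ χ_λ(r)`** for `0 < t ≤ 1`, `r > 0`, uniformly in `t`;
* `integrableOn_sphDecay_mul_kernel_mul_sinh` — `χ_λ(r) K_{λ₂}(r, s) sinh 2r` is integrable on `(0, ∞)`;
* `tendsto_integral_kernel_mul_kernel_nhdsGT_zero` — `∫ K_λ(t, r) K_{λ₂}(r, s) sinh 2r dr → −∫ χ_λ(r) K_{λ₂}(r, s) sinh 2r dr` as
  `t → 0⁺` (dominated convergence);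
* `integral_sphDecay_mul_kernel_eq` — **`∫_0^∞ χ_λ(r) K_{λ₂}(r, s) sinh 2r dr = (χ_λ(s) − χ_{λ₂}(s))/(μ − μ₂)`** for `λ ≠ λ₂`;
* `greenSolI_sphDecay_eq` — **`G^I_{λ₂} χ_λ(s) = (χ_λ(s) − χ_{λ₂}(s))/(μ − μ₂)`**: the resolvent of a decaying solution is the
  difference quotient of decaying solutions in the spectral parameter — the analogue, for the singular member of the basis, of
  row 4xx's `G^I_λ φ_{λ′} = φ_{λ′}/(μ′ − μ)`.

Nothing is claimed about (N).

Blind lane: Mathlib + the HodgeRepro2 prefix only; no sorry; axioms ⊆ {propext, Classical.choice,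
Quot.sound}.
-/

namespace Summit.Ventures.HodgeRepro2.T5SU11ResolventOfDecaySolution

open Filter Topology MeasureTheory
open Set (Ioi Ioc Icc)
open T5SU11Cartan T5SU11SphericalFunction T5SU11SphericalBounds T5SU11SphericalContinuous T5SU11SphericalDecay
  T5SU11ReductionOfOrder T5SU11RadialGreenKernel T5SU11RadialGreenImproper T5SU11RadialGreenImproperOrigin
  T5SU11RadialGreenImproperDecaySource T5SU11ResolventKernelComposition T5SU11ResolventTransformClass
  T5SU11KernelEnds T5SU11KernelResolventIdentity T5SU11KernelDifferenceRegularity T5SU11SphericalDecayFluxIdentity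
  T5SU11ReductionOfOrderInfinity T5SU11SphericalDecayBracket T5SU11SphericalCfun T5SU11SphericalAsymptotic
  T5SU11SphericalSolutionSpaceAll T5SU11ResolventCommute

/-- `sinh 2t · (log t)² → 0` as `t → 0⁺` (`(log t)² t = (log t · √t)²`, `sinh 2t ≤ 2t cosh 2`). -/
theorem tendsto_sinh_two_mul_mul_log_sq_nhdsGT_zero :
    Tendsto (fun t : ℝ => Real.sinh (2 * t) * Real.log t ^ 2) (𝓝[>] 0) (𝓝 0) := by
  have h1 : Tendsto (fun t : ℝ => (Real.log t * t ^ ((1 : ℝ) / 2)) ^ 2) (𝓝[>] 0) (𝓝 0) := by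
    have := (tendsto_log_mul_rpow_nhdsGT_zero (by norm_num : (0 : ℝ) < 1 / 2)).pow 2
    simpa using this
  have hlim : Tendsto (fun t : ℝ => 2 * Real.cosh 2 * (Real.log t * t ^ ((1 : ℝ) / 2)) ^ 2) (𝓝[>] 0) (𝓝 0) := by
    simpa using h1.const_mul (2 * Real.cosh 2)
  refine squeeze_zero_norm' ?_ hlim
  filter_upwards [Ioo_mem_nhdsGT one_pos] with t ht
  have hs : 0 ≤ Real.sinh (2 * t) := (sinh_two_mul_pos ht.1).le
  have hsq : (t ^ ((1 : ℝ) / 2)) ^ 2 = t := by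
    rw [← Real.sqrt_eq_rpow, Real.sq_sqrt ht.1.le]
  rw [Real.norm_eq_abs, abs_of_nonneg (mul_nonneg hs (sq_nonneg _)), mul_pow, hsq]
  have h := T5SU11ReductionOfOrderOrigin.sinh_two_mul_le_of_le_one ht.1.le ht.2.le
  calc Real.sinh (2 * t) * Real.log t ^ 2 ≤ 2 * t * Real.cosh 2 * Real.log t ^ 2 :=
        mul_le_mul_of_nonneg_right h (sq_nonneg _)
    _ = 2 * Real.cosh 2 * (Real.log t ^ 2 * t) := by ring

section measure

variable [MeasurableSpace Circle] [BorelSpace Circle]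

variable {lam lam₂ : ℝ} (hlam : 1 < lam) (hlam₂ : 1 < lam₂)

include hlam hlam₂ in
/-- **`χ_{λ₂} χ_λ sinh 2r → 0` as `r → 0⁺`**: the product of two logarithmic singularities against `sinh 2r`. -/
theorem tendsto_sphDecay_mul_sphDecay_mul_sinh_nhdsGT_zero :
    Tendsto (fun r => sphDecay lam₂ r * sphDecay lam r * Real.sinh (2 * r)) (𝓝[>] 0) (𝓝 0) := by
  obtain ⟨m₁, hm₁, hmin₁⟩ := exists_sph_hyp_sq_ge lam
  obtain ⟨m₂, hm₂, hmin₂⟩ := exists_sph_hyp_sq_ge lam₂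
  obtain ⟨Φ₁, hΦ₁, hΦle₁⟩ := exists_sph_hyp_le lam
  obtain ⟨Φ₂, hΦ₂, hΦle₂⟩ := exists_sph_hyp_le lam₂
  set T₁ := tailIntegral (fun t => sph lam (hyp t)) 1 with hT₁
  set T₂ := tailIntegral (fun t => sph lam₂ (hyp t)) 1 with hT₂
  have hT₁pos : 0 < T₁ := tailIntegral_pos (hφ_sph lam) (hpos_sph lam) (integrableOn_roIntegrand_sph hlam) one_pos
  have hT₂pos : 0 < T₂ := tailIntegral_pos (hφ_sph lam₂) (hpos_sph lam₂) (integrableOn_roIntegrand_sph hlam₂) one_pos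
  -- the majorant `Φ₁Φ₂ (T₁ + L/(2m₁))(T₂ + L/(2m₂)) sinh 2r`, `L = −log r`, tends to `0`
  have hlim : Tendsto (fun r : ℝ => Φ₁ * Φ₂ * (T₁ * T₂ * Real.sinh (2 * r)
      + (T₁ / (2 * m₂) + T₂ / (2 * m₁)) * (Real.sinh (2 * r) * (-Real.log r))
      + 1 / (4 * m₁ * m₂) * (Real.sinh (2 * r) * Real.log r ^ 2))) (𝓝[>] 0) (𝓝 0) := by
    have h1 := T5SU11SphericalDecayOriginFlux.tendsto_sinh_two_mul_nhdsGT_zero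
    have h2 := T5SU11SphericalDecayOriginFlux.tendsto_sinh_two_mul_mul_neg_log_nhdsGT_zero
    have h3 := tendsto_sinh_two_mul_mul_log_sq_nhdsGT_zero
    have := (((h1.const_mul (T₁ * T₂)).add (h2.const_mul (T₁ / (2 * m₂) + T₂ / (2 * m₁)))).add
      (h3.const_mul (1 / (4 * m₁ * m₂)))).const_mul (Φ₁ * Φ₂)
    simpa using this
  refine squeeze_zero_norm' ?_ hlim
  filter_upwards [Ioo_mem_nhdsGT one_pos] with r hr
  have hr0 : 0 < r := hr.1
  have hr1 : r ≤ 1 := hr.2.le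
  have hlog : 0 ≤ -Real.log r := neg_nonneg.mpr (Real.log_nonpos hr0.le hr1)
  have hs : 0 ≤ Real.sinh (2 * r) := (sinh_two_mul_pos hr0).le
  have hχ₁ : 0 < sphDecay lam r := sphDecay_pos hlam hr0
  have hχ₂ : 0 < sphDecay lam₂ r := sphDecay_pos hlam₂ hr0
  have hb₁ : sphDecay lam r ≤ Φ₁ * (T₁ + (-Real.log r) / (2 * m₁)) := by
    show sph lam (hyp r) * tailIntegral (fun t => sph lam (hyp t)) r ≤ _
    exact mul_le_mul (hΦle₁ r ⟨hr0.le, hr1⟩) (tailIntegral_le_of_le_one hlam hm₁ hmin₁ hr0 hr1)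
      (tailIntegral_pos (hφ_sph lam) (hpos_sph lam) (integrableOn_roIntegrand_sph hlam) hr0).le hΦ₁.le
  have hb₂ : sphDecay lam₂ r ≤ Φ₂ * (T₂ + (-Real.log r) / (2 * m₂)) := by
    show sph lam₂ (hyp r) * tailIntegral (fun t => sph lam₂ (hyp t)) r ≤ _
    exact mul_le_mul (hΦle₂ r ⟨hr0.le, hr1⟩) (tailIntegral_le_of_le_one hlam₂ hm₂ hmin₂ hr0 hr1)
      (tailIntegral_pos (hφ_sph lam₂) (hpos_sph lam₂) (integrableOn_roIntegrand_sph hlam₂) hr0).le hΦ₂.le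
  rw [Real.norm_eq_abs, abs_of_nonneg (mul_nonneg (mul_nonneg hχ₂.le hχ₁.le) hs)]
  have hA₁ : 0 ≤ Φ₁ * (T₁ + (-Real.log r) / (2 * m₁)) := by positivity
  have hA₂ : 0 ≤ Φ₂ * (T₂ + (-Real.log r) / (2 * m₂)) := by positivity
  calc sphDecay lam₂ r * sphDecay lam r * Real.sinh (2 * r)
      ≤ Φ₂ * (T₂ + (-Real.log r) / (2 * m₂)) * (Φ₁ * (T₁ + (-Real.log r) / (2 * m₁))) * Real.sinh (2 * r) :=
        mul_le_mul_of_nonneg_right (mul_le_mul hb₂ hb₁ hχ₁.le hA₂) hs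
    _ = Φ₁ * Φ₂ * (T₁ * T₂ * Real.sinh (2 * r)
        + (T₁ / (2 * m₂) + T₂ / (2 * m₁)) * (Real.sinh (2 * r) * (-Real.log r))
        + 1 / (4 * m₁ * m₂) * (Real.sinh (2 * r) * Real.log r ^ 2)) := by
        field_simp
        ring

include hlam hlam₂ in
/-- `χ_{λ₂} χ_λ sinh 2r` is integrable on `(0, 1]` (continuous, with limit `0` at the origin). -/
theorem integrableOn_sphDecay_mul_sphDecay_mul_sinh_Ioc_one :
    IntegrableOn (fun r => sphDecay lam₂ r * sphDecay lam r * Real.sinh (2 * r)) (Ioc 0 1) := by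
  have hcont : ContinuousOn (fun r => sphDecay lam₂ r * sphDecay lam r * Real.sinh (2 * r)) (Ioi 0) := by
    have hχ₁ : ContinuousOn (sphDecay lam) (Ioi 0) :=
      fun _ hr => (hasDerivAt_sphDecay hlam hr).continuousAt.continuousWithinAt
    have hχ₂ : ContinuousOn (sphDecay lam₂) (Ioi 0) :=
      fun _ hr => (hasDerivAt_sphDecay hlam₂ hr).continuousAt.continuousWithinAt
    exact (hχ₂.mul hχ₁).mul (Real.continuous_sinh.comp (continuous_const.mul continuous_id)).continuousOn
  -- bounded near `0` by the limit, on `[δ, 1]` by compactness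
  obtain ⟨δ, hδ0, hδ⟩ : ∃ δ : ℝ, 0 < δ ∧ ∀ r, 0 < r → r < δ →
      |sphDecay lam₂ r * sphDecay lam r * Real.sinh (2 * r)| ≤ 1 := by
    have h := (tendsto_sphDecay_mul_sphDecay_mul_sinh_nhdsGT_zero hlam hlam₂).eventually
      (eventually_abs_sub_lt 0 one_pos)
    rw [eventually_nhdsWithin_iff] at h
    obtain ⟨δ, hδ0, hδ⟩ := Metric.eventually_nhds_iff.mp h
    refine ⟨δ, hδ0, fun r hr0 hrδ => ?_⟩
    have := hδ (show dist r 0 < δ by rw [Real.dist_eq, sub_zero, abs_of_pos hr0]; exact hrδ) hr0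
    rw [sub_zero] at this
    exact this.le
  obtain ⟨C, hC⟩ := (isCompact_Icc (a := min δ 1) (b := 1)).exists_bound_of_continuousOn
    (hcont.mono fun r hr => lt_of_lt_of_le (lt_min hδ0 one_pos) hr.1)
  refine IntegrableOn.of_bound (by rw [Real.volume_Ioc]; exact ENNReal.ofReal_lt_top)
    ((hcont.mono Set.Ioc_subset_Ioi_self).aestronglyMeasurable measurableSet_Ioc) (max 1 C) ?_
  refine ae_restrict_of_forall_mem measurableSet_Ioc fun r hr => ?_
  rw [Real.norm_eq_abs]
  rcases lt_or_ge r (min δ 1) with h | h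
  · exact le_trans (hδ r hr.1 (lt_of_lt_of_le h (min_le_left _ _))) (le_max_left _ _)
  · exact le_trans (by simpa only [Real.norm_eq_abs] using hC r ⟨h, hr.2⟩) (le_max_right _ _)

include hlam hlam₂ in
/-- **`χ_{λ₂} χ_λ sinh 2r` is integrable on `(0, ∞)`** (`λ + λ₂ > 2`). -/
theorem integrableOn_sphDecay_mul_sphDecay_mul_sinh :
    IntegrableOn (fun r => sphDecay lam₂ r * sphDecay lam r * Real.sinh (2 * r)) (Ioi 0) := by
  have h1 := integrableOn_sphDecay_mul_sphDecay_mul_sinh_Ioc_one hlam hlam₂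
  -- the tail: `χ_λ(max r 1)` is a class source for `λ₂` at the rate `λ > 2 − λ₂`
  have hχ₁ : ContinuousOn (sphDecay lam) (Ioi 0) :=
    fun _ hr => (hasDerivAt_sphDecay hlam hr).continuousAt.continuousWithinAt
  have hg : ContinuousOn (fun r => sphDecay lam (max r 1)) (Ioi 0) := by
    refine hχ₁.comp (continuous_id.max continuous_const).continuousOn fun r hr => ?_
    exact lt_of_lt_of_le one_pos (le_max_right r 1)
  have hM : ∀ r ∈ Ioc (0 : ℝ) 1, |sphDecay lam (max r 1)| ≤ sphDecay lam 1 := by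
    intro r hr
    rw [max_eq_right hr.2, abs_of_pos (sphDecay_pos hlam one_pos)]
  obtain ⟨T₀, hT₀⟩ := eventually_atTop.mp (eventually_sphDecay_le hlam)
  have hC : ∀ r, max T₀ 1 ≤ r → |sphDecay lam (max r 1)| ≤ 2 * (1 / ((lam - 1) * cfun (2 - lam))) * Real.exp (-lam * r) := by
    intro r hr
    have hr1 : 1 ≤ r := le_trans (le_max_right _ _) hr
    rw [max_eq_left hr1, abs_of_pos (sphDecay_pos hlam (by linarith))]
    exact hT₀ r (le_trans (le_max_left _ _) hr)
  have hε : 2 - lam₂ < lam := by linarith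
  have h2 := integrableOn_sphDecay_mul_mul_sinh hlam₂ hg hM (sphDecay_pos hlam one_pos).le hε hC
  have h3 : IntegrableOn (fun r => sphDecay lam₂ r * sphDecay lam r * Real.sinh (2 * r)) (Ioi 1) := by
    refine (h2.mono_set (Set.Ioi_subset_Ioi zero_le_one)).congr_fun ?_ measurableSet_Ioi
    intro r hr
    have hr' : (1 : ℝ) < r := hr
    simp only [max_eq_left hr'.le]
  have := h1.union h3
  rwa [Set.Ioc_union_Ioi_eq_Ioi zero_le_one] at this

include hlam in
/-- **`|K_λ(t, r)| ≤ Φ χ_λ(r)`** for `0 < t ≤ 1` and `r > 0`, where `φ_λ ≤ Φ` on `[0, 1]`: a domination uniform in `t` near the origin. -/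
theorem abs_kernel_le_mul_sphDecay_of_le_one {Φ : ℝ} (hΦ : ∀ u ∈ Icc (0 : ℝ) 1, sph lam (hyp u) ≤ Φ)
    {t r : ℝ} (ht : 0 < t) (ht1 : t ≤ 1) (hr : 0 < r) : |sphGreenKernel lam t r| ≤ Φ * sphDecay lam r := by
  rcases le_total t r with htr | hrt
  · rw [kernel_eq_of_le lam htr, abs_neg, abs_of_pos (mul_pos (sphDecay_pos hlam hr) (sph_hyp_pos lam t))]
    have := hΦ t ⟨ht.le, ht1⟩
    have hχ : 0 < sphDecay lam r := sphDecay_pos hlam hr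
    nlinarith
  · rw [kernel_eq_of_ge lam hrt, abs_neg, abs_of_pos (mul_pos (sph_hyp_pos lam r) (sphDecay_pos hlam ht))]
    have h1 := hΦ r ⟨hr.le, le_trans hrt ht1⟩
    have h2 : sphDecay lam t ≤ sphDecay lam r := (sphDecay_strictAntiOn hlam).antitoneOn hr ht hrt
    have hχ : 0 < sphDecay lam t := sphDecay_pos hlam ht
    have hφ : 0 < sph lam (hyp r) := sph_hyp_pos lam r
    nlinarith

include hlam hlam₂ in
/-- `χ_λ(r) K_{λ₂}(r, s) sinh 2r` is integrable on `(0, ∞)` (the kernel's column is a class source at every rate `< λ₂`, row 503). -/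
theorem integrableOn_sphDecay_mul_kernel_mul_sinh {s : ℝ} (hs : 0 < s) :
    IntegrableOn (fun r => sphDecay lam r * sphGreenKernel lam₂ r s * Real.sinh (2 * r)) (Ioi 0) := by
  obtain ⟨M, hM0, hM⟩ := kernel_source_bounded hlam₂ hs
  obtain ⟨C, s₀, hC⟩ := kernel_source_decay hlam₂ hs
  have hg := kernel_source_continuousOn hlam₂ hs
  have hε : 2 - lam < lam₂ := by linarith
  exact integrableOn_sphDecay_mul_mul_sinh hlam hg hM hM0 hε hC

include hlam hlam₂ in
/-- **`∫ K_λ(t, r) K_{λ₂}(r, s) sinh 2r dr → −∫ χ_λ(r) K_{λ₂}(r, s) sinh 2r dr` as `t → 0⁺`** (dominated convergence). -/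
theorem tendsto_integral_kernel_mul_kernel_nhdsGT_zero {s : ℝ} (hs : 0 < s) :
    Tendsto (fun t => ∫ r in Ioi 0, sphGreenKernel lam t r * sphGreenKernel lam₂ r s * Real.sinh (2 * r)) (𝓝[>] 0)
      (𝓝 (-∫ r in Ioi 0, sphDecay lam r * sphGreenKernel lam₂ r s * Real.sinh (2 * r))) := by
  obtain ⟨Φ, hΦ0, hΦ⟩ := exists_sph_hyp_le lam
  have hint := integrableOn_sphDecay_mul_kernel_mul_sinh hlam hlam₂ hs
  have hbound : Integrable (fun r => Φ * |sphDecay lam r * sphGreenKernel lam₂ r s * Real.sinh (2 * r)|)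
      (volume.restrict (Ioi 0)) := hint.abs.const_mul Φ
  have hmeas : ∀ᶠ t in 𝓝[>] (0 : ℝ), AEStronglyMeasurable
      (fun r => sphGreenKernel lam t r * sphGreenKernel lam₂ r s * Real.sinh (2 * r)) (volume.restrict (Ioi 0)) := by
    filter_upwards [self_mem_nhdsWithin] with t ht
    -- the kernel's row is a class source; its product with the column and `sinh` is continuous on `(0, ∞)`
    have h1 : ContinuousOn (fun r => sphGreenKernel lam t r) (Ioi 0) := continuousOn_sphGreenKernel hlam ht
    have h2 := kernel_source_continuousOn hlam₂ hs
    exact ((h1.mul h2).mul (Real.continuous_sinh.comp (continuous_const.mul continuous_id)).continuousOn)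
      |>.aestronglyMeasurable measurableSet_Ioi
  have hdom : ∀ᶠ t in 𝓝[>] (0 : ℝ), ∀ᵐ r ∂(volume.restrict (Ioi 0)),
      ‖sphGreenKernel lam t r * sphGreenKernel lam₂ r s * Real.sinh (2 * r)‖
        ≤ Φ * |sphDecay lam r * sphGreenKernel lam₂ r s * Real.sinh (2 * r)| := by
    filter_upwards [Ioc_mem_nhdsGT one_pos] with t ht
    refine ae_restrict_of_forall_mem measurableSet_Ioi fun r hr => ?_
    have hr' : (0 : ℝ) < r := hr
    rw [Real.norm_eq_abs, abs_mul, abs_mul, abs_mul, abs_mul]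
    have hK := abs_kernel_le_mul_sphDecay_of_le_one hlam hΦ ht.1 ht.2 hr'
    have hχ : 0 < sphDecay lam r := sphDecay_pos hlam hr'
    rw [abs_of_pos hχ]
    have h1 : 0 ≤ |sphGreenKernel lam₂ r s| * |Real.sinh (2 * r)| := mul_nonneg (abs_nonneg _) (abs_nonneg _)
    calc |sphGreenKernel lam t r| * |sphGreenKernel lam₂ r s| * |Real.sinh (2 * r)|
        ≤ Φ * sphDecay lam r * |sphGreenKernel lam₂ r s| * |Real.sinh (2 * r)| := by
          have := mul_le_mul_of_nonneg_right hK h1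
          nlinarith [this]
      _ = Φ * (sphDecay lam r * |sphGreenKernel lam₂ r s| * |Real.sinh (2 * r)|) := by ring
  have hlim : ∀ᵐ r ∂(volume.restrict (Ioi 0)), Tendsto
      (fun t => sphGreenKernel lam t r * sphGreenKernel lam₂ r s * Real.sinh (2 * r)) (𝓝[>] 0)
      (𝓝 (-sphDecay lam r * sphGreenKernel lam₂ r s * Real.sinh (2 * r))) := by
    refine ae_restrict_of_forall_mem measurableSet_Ioi fun r hr => ?_
    have hr' : (0 : ℝ) < r := hr
    exact ((tendsto_kernel_nhdsGT_zero lam hr').mul_const _).mul_const _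
  have h := tendsto_integral_filter_of_dominated_convergence _ hmeas hdom hbound hlim
  have e : ∫ r in Ioi 0, -sphDecay lam r * sphGreenKernel lam₂ r s * Real.sinh (2 * r)
      = -∫ r in Ioi 0, sphDecay lam r * sphGreenKernel lam₂ r s * Real.sinh (2 * r) := by
    rw [← integral_neg]
    congr 1
    funext r
    ring
  rw [e] at h
  exact h

include hlam hlam₂ in
/-- **`∫_0^∞ χ_λ(r) K_{λ₂}(r, s) sinh 2r dr = (χ_λ(s) − χ_{λ₂}(s))/(μ − μ₂)`** for `λ ≠ λ₂`, `s > 0`. -/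
theorem integral_sphDecay_mul_kernel_eq (hne : lam ≠ lam₂) {s : ℝ} (hs : 0 < s) :
    ∫ r in Ioi 0, sphDecay lam r * sphGreenKernel lam₂ r s * Real.sinh (2 * r)
      = (sphDecay lam s - sphDecay lam₂ s) / (lam * (lam - 2) - lam₂ * (lam₂ - 2)) := by
  have hκ : lam * (lam - 2) - lam₂ * (lam₂ - 2) ≠ 0 := (mu_sub_ne_zero hlam hlam₂).mpr hne
  have h₁ := tendsto_integral_kernel_mul_kernel_nhdsGT_zero hlam hlam₂ hs
  have h₂ : Tendsto (fun t => ∫ r in Ioi 0, sphGreenKernel lam t r * sphGreenKernel lam₂ r s * Real.sinh (2 * r)) (𝓝[>] 0)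
      (𝓝 ((-sphDecay lam s - -sphDecay lam₂ s) / (lam * (lam - 2) - lam₂ * (lam₂ - 2)))) := by
    have h := ((tendsto_kernel_nhdsGT_zero lam hs).sub (tendsto_kernel_nhdsGT_zero lam₂ hs)).div_const
      (lam * (lam - 2) - lam₂ * (lam₂ - 2))
    refine h.congr' ?_
    filter_upwards [self_mem_nhdsWithin] with t ht
    exact (kernel_comp_eq hlam hlam₂ hne ht hs).symm
  have heq := tendsto_nhds_unique h₁ h₂
  have e : (-sphDecay lam s - -sphDecay lam₂ s) / (lam * (lam - 2) - lam₂ * (lam₂ - 2))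
      = -((sphDecay lam s - sphDecay lam₂ s) / (lam * (lam - 2) - lam₂ * (lam₂ - 2))) := by
    rw [← neg_div]
    congr 1
    ring
  rw [e] at heq
  linarith

include hlam hlam₂ in
/-- **THE RESOLVENT OF A DECAYING SOLUTION**: `G^I_{λ₂} χ_λ(s) = (χ_λ(s) − χ_{λ₂}(s))/(μ − μ₂)` for `λ ≠ λ₂`, `s > 0`. -/
theorem greenSolI_sphDecay_eq (hne : lam ≠ lam₂) {s : ℝ} (hs : 0 < s) :
    greenSolI (fun t => sph lam₂ (hyp t)) (sphDecay lam₂) (sphDecay lam) s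
      = (sphDecay lam s - sphDecay lam₂ s) / (lam * (lam - 2) - lam₂ * (lam₂ - 2)) := by
  -- the integrability of `χ_λ` against the basis of `λ₂`
  have hB : ∀ T, IntegrableOn (fun r => sph lam₂ (hyp r) * sphDecay lam r * Real.sinh (2 * r)) (Ioc 0 T) := by
    intro T
    have h := integrableOn_sphDecay_mul_sinh_Ioc hlam T
    obtain ⟨Φ, hΦ0, hΦ⟩ := exists_sph_hyp_le lam₂
    have hcont : ContinuousOn (fun r => sph lam₂ (hyp r) * sphDecay lam r * Real.sinh (2 * r)) (Ioi 0) := by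
      have hχ : ContinuousOn (sphDecay lam) (Ioi 0) :=
        fun _ hr => (hasDerivAt_sphDecay hlam hr).continuousAt.continuousWithinAt
      exact ((continuous_sph_hyp lam₂).continuousOn.mul hχ).mul
        (Real.continuous_sinh.comp (continuous_const.mul continuous_id)).continuousOn
    -- `φ_{λ₂}` is bounded on `(0, T]` by continuity: dominate by `Φ_T · χ_λ sinh 2r`
    obtain ⟨Φ', hΦ'⟩ : ∃ Φ' : ℝ, ∀ r ∈ Ioc (0 : ℝ) T, |sph lam₂ (hyp r)| ≤ Φ' := by
      obtain ⟨Φ', hΦ'⟩ := (isCompact_Icc (a := (0 : ℝ)) (b := T)).exists_bound_of_continuousOn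
        (continuous_sph_hyp lam₂).continuousOn
      exact ⟨Φ', fun r hr => by simpa only [Real.norm_eq_abs] using hΦ' r ⟨hr.1.le, hr.2⟩⟩
    refine (h.const_mul Φ').mono' ((hcont.mono Set.Ioc_subset_Ioi_self).aestronglyMeasurable measurableSet_Ioc) ?_
    refine ae_restrict_of_forall_mem measurableSet_Ioc fun r hr => ?_
    have hr' : (0 : ℝ) < r := hr.1
    rw [Real.norm_eq_abs, abs_mul, abs_mul, abs_of_pos (sphDecay_pos hlam hr'),
      abs_of_pos (sinh_two_mul_pos hr')]
    have := hΦ' r hr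
    have hχ : 0 < sphDecay lam r := sphDecay_pos hlam hr'
    have hsh : 0 < Real.sinh (2 * r) := sinh_two_mul_pos hr'
    calc |sph lam₂ (hyp r)| * sphDecay lam r * Real.sinh (2 * r)
        ≤ Φ' * sphDecay lam r * Real.sinh (2 * r) := by
          have := mul_le_mul_of_nonneg_right (mul_le_mul_of_nonneg_right this hχ.le) hsh.le
          linarith
      _ = Φ' * (sphDecay lam r * Real.sinh (2 * r)) := by ring
  have hA : IntegrableOn (fun r => sphDecay lam₂ r * sphDecay lam r * Real.sinh (2 * r)) (Ioi 0) :=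
    integrableOn_sphDecay_mul_sphDecay_mul_sinh hlam hlam₂
  rw [greenSolI_eq_integral_kernel hB hA hs, ← integral_sphDecay_mul_kernel_eq hlam hlam₂ hne hs]
  apply setIntegral_congr_fun measurableSet_Ioi
  intro r _
  simp only [sphGreenKernel]
  rw [greenKernel_symm]
  ring

end measure

end Summit.Ventures.HodgeRepro2.T5SU11ResolventOfDecaySolution
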